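import Summits.AtomisticToContinuum.Crystallization.Theorems.PhononSlackCertificatesPeriodicGivenLayeredWindowBounds1
import Summits.AtomisticToContinuum.Crystallization.Theorems.ExcessDecayLiouvilleFineGrainsFlatComparison
import Summits.AtomisticToContinuum.Crystallization.Theorems.ExcessDecayLiouvilleCrysEnergyLimit
import Summits.AtomisticToContinuum.Crystallization.Theorems.HullExactificationCascadeHullBulkOptimalCut
import Literature.MathematicalPhysics.StatisticalMechanics.LennardJonesThermodynamicLimitProofs
import Literature.MathematicalPhysics.StatisticalMechanics.LocalMatchingCompactness
import Mathlib.NumberTheory.ZetaValues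

/-!
# Crux `BarlowLiouville` (stmt-AtomisticToContinuum-15801), line `Sketch` — the `c = 0` half of the tube price inequality

Helper file toward the registered kernel stub `stub_price` of the lead skeleton
`DisclinationRationBarlowLiouville` (lead prover-line-stmt-AtomisticToContinuum-15801-0). The price
inequality reads `c·#bad − C(L+1)² ≤ Σ_{y ∈ X ∩ B̄_L(ctr)} Σ'_{z ∈ X, z ≠ y} V(dist y z) − 2e⋆ #(X ∩ B̄_L(ctr))`;
this file proves its `c = 0` skeleton — the TRIVIAL LOWER BOUND of the ball site-energy sums of a
`δ`-separated relatively dense set by `2e⋆` per point up to a surface term — which every proof of the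
kernel starts from, together with its two reusable ingredients:

* `iInf_periodic_le_groundStateEnergy_div` — `e⋆ = ⨅_{Q periodic} e(Q) ≤ E(N)/N` for `N ≥ 1`
  (`E(N)/N → e⋆`, item 0626, and Fekete `inf_N E(N)/N = lim`, `BlancLewin2015_8_holds`), hence
  `N · e⋆ ≤ E(N)` (`card_mul_iInf_periodic_le_groundStateEnergy`);
* `sum_boundaryWeight_ball_le` — the BOUNDARY FUNCTIONAL OF BALLS: for a `δ`-separated `X` and the finite
  set `W = X ∩ B̄_L(ctr)` with `X ∖ W ≠ ∅`, `Σ_{p ∈ W} (1 + dist(p, X ∖ W))⁻³ ≤ C_δ (L + 1)²`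
  (depth shells counted by the landed `card_shell_le`, `Σ_k (1+k)⁻³ ≤ Σ 1/n² = π²/6`);
* `trivial_price` — for `δ`-separated relatively dense `X`:
  `−C (L+1)² ≤ Σ_{y ∈ X ∩ B̄_L(ctr)} Σ'_{z ∈ X, z ≠ y} V_LJ(dist y z) − 2e⋆ · #(X ∩ B̄_L(ctr))` for all `ctr, L`
  (the landed window lower bound `LayeredHull.wb_lower` + the two lemmas above).
No definitions. [folklore] throughout.
-/

noncomputable section

namespace Summit.AtomisticToContinuum.Crystallization.Theorems.DisclinationRationBarlowLiouville

open scoped BigOperators Topology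
open Filter Metric Literature.MathematicalPhysics.StatisticalMechanics
open Summit.AtomisticToContinuum.Crystallization.Theorems.ExcessDecayLiouvilleFineGrains (card_shell_le)
open Summit.AtomisticToContinuum.Crystallization.Theorems.HullBulkOptimal (tsum_finite_eq_sum)
-- `E3 = EuclideanSpace ℝ (Fin 3)` as the (reducible) library abbreviation (no notation declared here).
open Summit.AtomisticToContinuum.Crystallization.Theorems.ChargedEnergyGapNegative (E3)

/-! ## `e⋆ ≤ E(N)/N` -/

/-- `e⋆ = ⨅_{Q periodic} e_LJ(Q) ≤ E(N)/N` for every `N ≥ 1`: `E(N)/N → e⋆` (item 0626,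
`crysEnergyLimit_proof`) and `E(N)/N → e_∞ = inf_{N ≥ 1} E(N)/N` (Fekete, `BlancLewin2015_8_holds`), so
`e⋆ = e_∞ ≤ E(N)/N`. [folklore] -/
theorem iInf_periodic_le_groundStateEnergy_div {N : ℕ} (hN : 0 < N) :
    (⨅ Q : PeriodicConfiguration 3, Q.energyPerParticle lennardJones) ≤
      groundStateEnergy lennardJones 3 N / (N : ℝ) := by
  obtain ⟨e, -, htend, hle⟩ := BlancLewin2015_8_holds 3 (by norm_num) (by norm_num)
  have h := crysEnergyLimit_proof
  unfold Summit.AtomisticToContinuum.Crystallization.Theses.ExcessDecayLiouville.CrysEnergyLimit at h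
  have heq : e = ⨅ Q : PeriodicConfiguration 3, Q.energyPerParticle lennardJones :=
    tendsto_nhds_unique htend h
  rw [← heq]
  exact hle N hN

/-- `N · e⋆ ≤ E(N)` for every `N` (for `N = 0` both sides vanish, `E(0) = 0`). [folklore] -/
theorem card_mul_iInf_periodic_le_groundStateEnergy (N : ℕ) :
    (N : ℝ) * (⨅ Q : PeriodicConfiguration 3, Q.energyPerParticle lennardJones) ≤
      groundStateEnergy lennardJones 3 N := by
  rcases Nat.eq_zero_or_pos N with rfl | hN
  · simp [groundStateEnergy_of_le_one lennardJones (zero_le_one : 0 ≤ 1)]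
  · have h := iInf_periodic_le_groundStateEnergy_div hN
    have hN' : (0 : ℝ) < N := by exact_mod_cast hN
    rwa [le_div_iff₀ hN', mul_comm] at h

/-! ## The boundary functional of balls -/

/-- `Σ_{k < K} ((1 + k)⁻¹)³ ≤ 2` (termwise `≤ 1/(k+1)²`, and `Σ_n 1/n² = π²/6 < 2`). [folklore] -/
theorem sum_inv_one_add_pow_three_le_two (K : ℕ) :
    ∑ k ∈ Finset.range K, ((1 + (k : ℝ))⁻¹) ^ 3 ≤ 2 := by
  have hsum : HasSum (fun n : ℕ => 1 / (n : ℝ) ^ 2) (Real.pi ^ 2 / 6) := hasSum_zeta_two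
  set f : ℕ → ℝ := fun n => 1 / (n : ℝ) ^ 2 with hf
  have h1 : ∑ k ∈ Finset.range K, ((1 + (k : ℝ))⁻¹) ^ 3 ≤ ∑ k ∈ Finset.range K, f (1 + k) := by
    refine Finset.sum_le_sum fun k _ => ?_
    have hk1 : (1 : ℝ) ≤ 1 + k := by
      have : (0 : ℝ) ≤ k := Nat.cast_nonneg _
      linarith
    simp only [hf, Nat.cast_add, Nat.cast_one, one_div, ← inv_pow]
    exact pow_le_pow_of_le_one (by positivity) (inv_le_one_of_one_le₀ hk1) (by norm_num)
  have h3 : ∑ k ∈ Finset.range K, f (1 + k) = ∑ i ∈ Finset.Ico 1 (1 + K), f i := by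
    rw [Finset.sum_Ico_eq_sum_range, Nat.add_sub_cancel_left]
  have h2 : ∑ i ∈ Finset.Ico 1 (1 + K), f i ≤ Real.pi ^ 2 / 6 :=
    sum_le_hasSum _ (fun n _ => by positivity) hsum
  have h4 : Real.pi ^ 2 / 6 ≤ 2 := by
    have := Real.pi_lt_d2
    nlinarith [Real.pi_pos]
  linarith

/-- **The boundary functional of balls.** For a `δ`-separated `X ⊆ ℝ³`, a centre `ctr`, a radius `L`,
the finite set `W = X ∩ B̄_L(ctr)` (given as a `Finset` with the membership characterisation `hW`) and
`X ∖ W` nonempty: `Σ_{p ∈ W} (1 + dist(p, X ∖ W))⁻³ ≤ (48 (1 + δ)/δ³) · (L + 1 + δ)²`.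
Depth shells `k ≤ L − dist p ctr < k + 1` have `≤ 24(1+δ)(L − k + δ/2)²/δ³` points (`card_shell_le`) and
weight `≤ (1+k)⁻³`, and `Σ_k (1+k)⁻³ ≤ 2`. [folklore] -/
theorem sum_boundaryWeight_ball_le {δ : ℝ} (hδ : 0 < δ) {X : Set E3}
    (hsep : ∀ p ∈ X, ∀ q ∈ X, p ≠ q → δ ≤ dist p q) (ctr : E3) (L : ℝ) (W : Finset E3)
    (hW : ∀ p, p ∈ W ↔ p ∈ X ∧ dist p ctr ≤ L) (hne : (X \ (↑W : Set E3)).Nonempty) :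
    ∑ p ∈ W, (1 + Metric.infDist p (X \ (↑W : Set E3)))⁻¹ ^ 3 ≤
      48 * (1 + δ) / δ ^ 3 * (L + 1 + δ) ^ 2 := by
  classical
  -- depth of a point of `W`
  have hdepth : ∀ p ∈ W, L - dist p ctr ≤ Metric.infDist p (X \ (↑W : Set E3)) := by
    intro p hp
    rw [Metric.le_infDist hne]
    intro q hq
    have hqX : q ∈ X := hq.1
    have hqL : ¬ dist q ctr ≤ L := fun h => hq.2 ((hW q).2 ⟨hqX, h⟩)
    push Not at hqL
    have := dist_triangle q p ctr
    rw [dist_comm q p] at this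
    linarith
  -- shell index
  set m : E3 → ℕ := fun p => ⌊L - dist p ctr⌋₊ with hm
  have hmem : ∀ p ∈ W, p ∈ X ∧ dist p ctr ≤ L := fun p hp => (hW p).1 hp
  -- pointwise weight bound by the shell index
  have hpt : ∀ p ∈ W, (1 + Metric.infDist p (X \ (↑W : Set E3)))⁻¹ ^ 3 ≤ ((1 + (m p : ℝ))⁻¹) ^ 3 := by
    intro p hp
    have h0 : 0 ≤ L - dist p ctr := by linarith [(hmem p hp).2]
    have hfl : (m p : ℝ) ≤ L - dist p ctr := Nat.floor_le h0
    have hd := hdepth p hp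
    have hpos : (0 : ℝ) < 1 + (m p : ℝ) := by positivity
    have hle : 1 + (m p : ℝ) ≤ 1 + Metric.infDist p (X \ (↑W : Set E3)) := by linarith
    have hnn : 0 ≤ (1 + Metric.infDist p (X \ (↑W : Set E3)))⁻¹ :=
      inv_nonneg.2 (add_nonneg zero_le_one Metric.infDist_nonneg)
    exact pow_le_pow_left₀ hnn (inv_anti₀ hpos hle) 3
  -- the shells and their cardinalities
  have hK : ∀ p ∈ W, m p ∈ Finset.range (⌊L⌋₊ + 1) := by
    intro p hp
    rw [Finset.mem_range, Nat.lt_succ_iff]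
    exact Nat.floor_le_floor (by linarith [dist_nonneg (x := p) (y := ctr)])
  have hshell : ∀ k ∈ Finset.range (⌊L⌋₊ + 1),
      ((W.filter fun p => m p = k).card : ℝ) ≤ 24 * (1 + δ) * (L + 1 + δ) ^ 2 / δ ^ 3 := by
    intro k hk
    by_cases hWk : (W.filter fun p => m p = k) = ∅
    · rw [hWk, Finset.card_empty, Nat.cast_zero]
      positivity
    obtain ⟨p₀, hp₀⟩ := Finset.nonempty_iff_ne_empty.2 hWk
    have hp₀W := (Finset.mem_filter.1 hp₀).1
    have hb : 0 ≤ L - k := by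
      have h0 : 0 ≤ L - dist p₀ ctr := by linarith [(hmem p₀ hp₀W).2]
      have : (m p₀ : ℝ) ≤ L - dist p₀ ctr := Nat.floor_le h0
      rw [(Finset.mem_filter.1 hp₀).2] at this
      linarith [dist_nonneg (x := p₀) (y := ctr)]
    have hs : ∀ c ∈ W.filter (fun p => m p = k), (L - k) - 1 < dist c ctr ∧ dist c ctr ≤ L - k := by
      intro c hc
      obtain ⟨hcW, hck⟩ := Finset.mem_filter.1 hc
      have h0 : 0 ≤ L - dist c ctr := by linarith [(hmem c hcW).2]
      have h1 : ((m c : ℕ) : ℝ) ≤ L - dist c ctr := Nat.floor_le h0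
      have h2 : L - dist c ctr < (m c : ℝ) + 1 := Nat.lt_floor_add_one _
      rw [hck] at h1 h2
      constructor <;> linarith
    have hsep' : ∀ c ∈ W.filter (fun p => m p = k), ∀ d ∈ W.filter (fun p => m p = k), c ≠ d →
        δ ≤ dist c d := fun c hc d hd hcd =>
      hsep c (hmem c (Finset.mem_filter.1 hc).1).1 d (hmem d (Finset.mem_filter.1 hd).1).1 hcd
    have key := card_shell_le (W.filter fun p => m p = k) ctr hδ hb hs hsep'
    have hmono : 24 * (1 + δ) * (L - k + δ / 2) ^ 2 / δ ^ 3 ≤ 24 * (1 + δ) * (L + 1 + δ) ^ 2 / δ ^ 3 := by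
      have hk0 : (0 : ℝ) ≤ k := Nat.cast_nonneg _
      have h1 : (L - k + δ / 2) ^ 2 ≤ (L + 1 + δ) ^ 2 := by nlinarith
      have h2 : 0 ≤ 24 * (1 + δ) := by positivity
      exact div_le_div_of_nonneg_right (mul_le_mul_of_nonneg_left h1 h2) (by positivity)
    exact key.trans hmono
  -- regroup by shells
  calc ∑ p ∈ W, (1 + Metric.infDist p (X \ (↑W : Set E3)))⁻¹ ^ 3
      ≤ ∑ p ∈ W, ((1 + (m p : ℝ))⁻¹) ^ 3 := Finset.sum_le_sum hpt
    _ = ∑ k ∈ Finset.range (⌊L⌋₊ + 1), ∑ p ∈ W.filter (fun p => m p = k), ((1 + (m p : ℝ))⁻¹) ^ 3 :=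
        (Finset.sum_fiberwise_of_maps_to hK _).symm
    _ = ∑ k ∈ Finset.range (⌊L⌋₊ + 1), ((W.filter fun p => m p = k).card : ℝ) * ((1 + (k : ℝ))⁻¹) ^ 3 := by
        refine Finset.sum_congr rfl fun k _ => ?_
        rw [Finset.sum_congr rfl fun p hp => by rw [(Finset.mem_filter.1 hp).2], Finset.sum_const,
          nsmul_eq_mul]
    _ ≤ ∑ k ∈ Finset.range (⌊L⌋₊ + 1), (24 * (1 + δ) * (L + 1 + δ) ^ 2 / δ ^ 3) * ((1 + (k : ℝ))⁻¹) ^ 3 :=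
        Finset.sum_le_sum fun k hk => mul_le_mul_of_nonneg_right (hshell k hk) (by positivity)
    _ = (24 * (1 + δ) * (L + 1 + δ) ^ 2 / δ ^ 3) * ∑ k ∈ Finset.range (⌊L⌋₊ + 1), ((1 + (k : ℝ))⁻¹) ^ 3 := by
        rw [Finset.mul_sum]
    _ ≤ (24 * (1 + δ) * (L + 1 + δ) ^ 2 / δ ^ 3) * 2 :=
        mul_le_mul_of_nonneg_left (sum_inv_one_add_pow_three_le_two _) (by positivity)
    _ = 48 * (1 + δ) / δ ^ 3 * (L + 1 + δ) ^ 2 := by ring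

/-! ## The trivial (`c = 0`) price inequality -/

/-- A point of `X` outside `B̄_L(ctr)` from relative density: some point of `X` is within `R₁` of
`ctr + (L + R₁ + 1)e₀`, hence at distance `> L` from `ctr`. [folklore] -/
theorem exists_mem_not_mem_ball {X : Set E3} {R₁ : ℝ} (hdense : ∀ p : E3, ∃ y ∈ X, dist y p ≤ R₁)
    (ctr : E3) {L : ℝ} (hL : 0 ≤ L) : ∃ y ∈ X, L < dist y ctr := by
  have hR₁ : 0 ≤ R₁ := by
    obtain ⟨y, -, hy⟩ := hdense ctr
    exact dist_nonneg.trans hy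
  set v : E3 := EuclideanSpace.single 0 (L + R₁ + 1) with hv
  have hvn : ‖v‖ = L + R₁ + 1 := by
    rw [hv, PiLp.norm_single, Real.norm_eq_abs, abs_of_nonneg (by linarith)]
  obtain ⟨y, hyX, hy⟩ := hdense (ctr + v)
  refine ⟨y, hyX, ?_⟩
  have h1 : dist (ctr + v) ctr = L + R₁ + 1 := by rw [dist_eq_norm, add_sub_cancel_left, hvn]
  have h2 := dist_triangle (ctr + v) y ctr
  rw [dist_comm (ctr + v) y] at h2
  linarith

/-- **The trivial price inequality (`c = 0`).** For every `δ > 0` and every `δ`-separated, relatively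
dense `X ⊆ ℝ³` there is `C` such that for every centre `ctr` and radius `L`:
`−C (L+1)² ≤ Σ_{y ∈ X ∩ B̄_L(ctr)} Σ'_{z ∈ X, z ≠ y} V_LJ(dist y z) − 2 e⋆ · #(X ∩ B̄_L(ctr))`,
`e⋆ = ⨅_{Q periodic} e_LJ(Q)` — the registered kernel `stub_price` with the bad-point term dropped, in
exactly its spelling. Proof: the landed window lower bound `LayeredHull.wb_lower`
(`2E(#W) − C_δ·∂W ≤ Σ_W e_p(X)`), `#W · e⋆ ≤ E(#W)` and the boundary functional of balls
`∂W ≤ C_δ'(L+1)²`. [folklore] -/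
theorem trivial_price : ∀ δ : ℝ, 0 < δ → ∀ X : Set E3, (∀ y ∈ X, ∀ z ∈ X, y ≠ z → δ ≤ dist y z) →
    (∃ R₁ : ℝ, ∀ p : E3, ∃ y ∈ X, dist y p ≤ R₁) →
    ∃ C : ℝ, ∀ (ctr : E3) (L : ℝ),
      -(C * (L + 1) ^ 2) ≤
      (∑' y : ↥{y : E3 | y ∈ X ∧ dist y ctr ≤ L},
          ∑' z : ↥{z : E3 | z ∈ X ∧ z ≠ (y : E3)}, lennardJones (dist (y : E3) (z : E3)))
        - 2 * (⨅ Q : PeriodicConfiguration 3, Q.energyPerParticle lennardJones)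
            * (({y : E3 | y ∈ X ∧ dist y ctr ≤ L} : Set E3).ncard : ℝ) := by
  intro δ hδ X hsep hdense
  obtain ⟨R₁, hR₁⟩ := hdense
  obtain ⟨C₁, hC₁⟩ := LayeredHull.wb_lower δ hδ
  set estar : ℝ := ⨅ Q : PeriodicConfiguration 3, Q.energyPerParticle lennardJones with hestar
  refine ⟨max C₁ 0 * (48 * (1 + δ) / δ ^ 3) * (1 + δ) ^ 2, fun ctr L => ?_⟩
  set Wset : Set E3 := {y : E3 | y ∈ X ∧ dist y ctr ≤ L} with hWset
  have hfin : Wset.Finite :=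
    finite_of_forall_le_dist_of_subset_closedBall hδ
      (fun p hp q hq hpq => hsep p hp.1 q hq.1 hpq) (c := ctr) (R := L)
      (fun p hp => mem_closedBall.2 hp.2)
  have hWf : ∀ p, p ∈ hfin.toFinset ↔ p ∈ X ∧ dist p ctr ≤ L := fun p => by
    rw [Set.Finite.mem_toFinset]; rfl
  have hsub : (↑hfin.toFinset : Set E3) ⊆ X := fun p hp => ((hWf p).1 hp).1
  have hK0 : 0 ≤ max C₁ 0 * (48 * (1 + δ) / δ ^ 3) * (1 + δ) ^ 2 := by positivity
  -- outer `tsum` = `Finset` sum; `ncard` = `card`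
  have htsum : (∑' y : ↥Wset, ∑' z : ↥{z : E3 | z ∈ X ∧ z ≠ (y : E3)}, lennardJones (dist (y : E3) (z : E3)))
      = ∑ y ∈ hfin.toFinset, ∑' z : ↥{z : E3 | z ∈ X ∧ z ≠ y}, lennardJones (dist y (z : E3)) :=
    tsum_finite_eq_sum hfin (fun y => ∑' z : ↥{z : E3 | z ∈ X ∧ z ≠ y}, lennardJones (dist y (z : E3)))
  have hncard : (Wset.ncard : ℝ) = hfin.toFinset.card := by
    rw [Set.ncard_eq_toFinset_card Wset hfin]
  rw [htsum, hncard]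
  by_cases hW0 : hfin.toFinset = ∅
  · rw [hW0]
    simp only [Finset.sum_empty, Finset.card_empty, Nat.cast_zero, mul_zero, sub_zero]
    have : 0 ≤ max C₁ 0 * (48 * (1 + δ) / δ ^ 3) * (1 + δ) ^ 2 * (L + 1) ^ 2 := by positivity
    linarith
  -- main case: `W ≠ ∅`, so `L ≥ 0`
  obtain ⟨p₀, hp₀⟩ := Finset.nonempty_iff_ne_empty.2 hW0
  have hL : 0 ≤ L := dist_nonneg.trans ((hWf p₀).1 hp₀).2
  -- a point of `X` outside the ball
  have hne : (X \ (↑hfin.toFinset : Set E3)).Nonempty := by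
    obtain ⟨y, hyX, hy⟩ := exists_mem_not_mem_ball hR₁ ctr hL
    exact ⟨y, hyX, fun h => (not_le.2 hy) ((hWf y).1 h).2⟩
  -- the three ingredients
  have hlow := hC₁ X hsep hfin.toFinset hsub
  have hE := card_mul_iInf_periodic_le_groundStateEnergy hfin.toFinset.card
  have hbd := sum_boundaryWeight_ball_le hδ hsep ctr L hfin.toFinset hWf hne
  have hw0 : 0 ≤ ∑ p ∈ hfin.toFinset, (1 + Metric.infDist p (X \ (↑hfin.toFinset : Set E3)))⁻¹ ^ 3 :=
    Finset.sum_nonneg fun p _ => pow_nonneg (inv_nonneg.2 (add_nonneg zero_le_one Metric.infDist_nonneg)) _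
  -- `C₁ Σw ≤ max(C₁,0) Σw ≤ max(C₁,0) · B ≤ C (L+1)²`
  have h1 : C₁ * ∑ p ∈ hfin.toFinset, (1 + Metric.infDist p (X \ (↑hfin.toFinset : Set E3)))⁻¹ ^ 3 ≤
      max C₁ 0 * (48 * (1 + δ) / δ ^ 3 * (L + 1 + δ) ^ 2) :=
    (mul_le_mul_of_nonneg_right (le_max_left _ _) hw0).trans
      (mul_le_mul_of_nonneg_left hbd (le_max_right _ _))
  have h2 : (L + 1 + δ) ^ 2 ≤ (1 + δ) ^ 2 * (L + 1) ^ 2 := by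
    have : L + 1 + δ ≤ (1 + δ) * (L + 1) := by nlinarith
    have h0 : 0 ≤ L + 1 + δ := by linarith
    calc (L + 1 + δ) ^ 2 ≤ ((1 + δ) * (L + 1)) ^ 2 := pow_le_pow_left₀ h0 this 2
      _ = (1 + δ) ^ 2 * (L + 1) ^ 2 := by ring
  have h3 : max C₁ 0 * (48 * (1 + δ) / δ ^ 3 * (L + 1 + δ) ^ 2) ≤
      max C₁ 0 * (48 * (1 + δ) / δ ^ 3) * (1 + δ) ^ 2 * (L + 1) ^ 2 := by
    have hA : 0 ≤ max C₁ 0 * (48 * (1 + δ) / δ ^ 3) := by positivity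
    have := mul_le_mul_of_nonneg_left h2 hA
    nlinarith
  -- assemble (the inner `tsum`s of `wb_lower` and of the goal agree definitionally)
  have hlow' : 2 * groundStateEnergy lennardJones 3 hfin.toFinset.card -
      C₁ * ∑ p ∈ hfin.toFinset, (1 + Metric.infDist p (X \ (↑hfin.toFinset : Set E3)))⁻¹ ^ 3 ≤
      ∑ y ∈ hfin.toFinset, ∑' z : ↥{z : E3 | z ∈ X ∧ z ≠ y}, lennardJones (dist y (z : E3)) := hlow
  nlinarith [hlow', hE, h1, h3]

end Summit.AtomisticToContinuum.Crystallization.Theorems.DisclinationRationBarlowLiouville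

end
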